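import Mathlib
import HarnessLib

/-!
# Maximal minors of an embedding with torsion cokernel do not depend on the embedding

Stub `stub_minor_embedding_indep` of crux `HigherRankTermination`
(stmt-ResolutionOfSingularities-17045), line `birth`: pure linear algebra, no tower vocabulary.

Let `R` be a commutative ring whose structure map to a field `K` is injective, `M` an
`R`-module and `ι ι' : M →ₗ[R] (Fin r → R)` two injective linear maps with torsion cokernels.
Then the maximal minors `det (algebraMap R K (ι' (g i) j))ᵢⱼ` and
`det (algebraMap R K (ι (g i) j))ᵢⱼ` on every `r`-tuple `g` of elements of `M` differ by ONE
non-zero constant `c ∈ K`.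

Proof. Choose `m j ∈ M` and `a j ≠ 0` with `ι (m j) = a j • Pi.single j 1` (torsion cokernel).
The matrix `Q` with `j`-th row `(a j)⁻¹ • ι'_K (m j)` satisfies `ι'_K x = ι_K x ᵥ* Q` for every
`x : M` (`minorEmbedding_exists_matrix_vecMul_eq`): with `A := ∏ a j` one has
`A • x = ∑ j, (ι x j * ∏_{i ≠ j} a i) • m j` by injectivity of `ι`, so both sides, multiplied by
`algebraMap R K A ≠ 0`, become the same sum. Hence the `ι'`-minor matrix of `g` is the
`ι`-minor matrix of `g` times `Q` and `c := det Q` works (`minorEmbedding_exists_det_eq_mul_det`).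
Finally `c ≠ 0`: the symmetric statement gives `c'` with `det_ι = c' * det_ι'`, and the
`ι`-minor on the tuple `(m j)ⱼ` is `∏ algebraMap R K (a j) ≠ 0`
(`minorEmbedding_exists_det_ne_zero`).
-/

noncomputable section

set_option linter.dupNamespace false

namespace Summit.ResolutionOfSingularities.ResolutionOfSingularities.Theorems.SyzygyFlattening

/-- **Change of embedding matrix.** If `ι : M →ₗ[R] (Fin r → R)` is injective with torsion
cokernel and `ι' : M →ₗ[R] (Fin r' → R)` is any linear map, then over a field `K` into which `R`
embeds there is ONE matrix `Q` with `ι'_K x = ι_K x ᵥ* Q` for all `x : M`, where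
`ι_K x = algebraMap R K ∘ ι x`. -/
theorem minorEmbedding_exists_matrix_vecMul_eq (R K : Type) [CommRing R] [Field K]
    [Algebra R K] (hRK : Function.Injective (algebraMap R K)) (M : Type) [AddCommGroup M]
    [Module R M] (r r' : ℕ) (ι : M →ₗ[R] (Fin r → R)) (ι' : M →ₗ[R] (Fin r' → R))
    (hι : Function.Injective ι)
    (htor : ∀ z : Fin r → R, ∃ a : R, a ≠ 0 ∧ a • z ∈ LinearMap.range ι) :
    ∃ Q : Matrix (Fin r) (Fin r') K, ∀ x : M,
      (fun j => algebraMap R K (ι' x j)) =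
        Matrix.vecMul (fun j => algebraMap R K (ι x j)) Q := by
  classical
  choose a ha hm using fun j : Fin r => htor (Pi.single j 1)
  choose m hm using fun j => LinearMap.mem_range.1 (hm j)
  have haK : ∀ j, algebraMap R K (a j) ≠ 0 := fun j => (map_ne_zero_iff _ hRK).2 (ha j)
  refine ⟨Matrix.of fun j l => (algebraMap R K (a j))⁻¹ * algebraMap R K (ι' (m j) l), ?_⟩
  intro x
  -- the common denominator `∏ j, a j` is non-zero in `K`
  have hAK : algebraMap R K (∏ j, a j) ≠ 0 := by
    rw [map_prod]
    exact Finset.prod_ne_zero_iff.2 fun j _ => haK j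
  have hAj : ∀ j, algebraMap R K (∏ i, a i) * (algebraMap R K (a j))⁻¹ =
      algebraMap R K (∏ i ∈ Finset.univ.erase j, a i) := by
    intro j
    rw [← Finset.prod_erase_mul Finset.univ a (Finset.mem_univ j), map_mul, mul_assoc,
      mul_inv_cancel₀ (haK j), mul_one]
  -- `(∏ a j) • x` lies in the span of the `m j`, with explicit coefficients
  have hx : (∏ j, a j) • x = ∑ j, (ι x j * ∏ i ∈ Finset.univ.erase j, a i) • m j := by
    apply hι
    funext l
    simp only [map_smul, map_sum, hm, Pi.smul_apply, Finset.sum_apply, smul_eq_mul,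
      Pi.single_apply, mul_ite, mul_one, mul_zero, Finset.sum_ite_eq, Finset.mem_univ,
      if_true]
    rw [← Finset.prod_erase_mul Finset.univ a (Finset.mem_univ l)]
    ring
  funext l
  apply mul_left_cancel₀ hAK
  have h0 : (∏ j, a j) * ι' x l = ι' ((∏ j, a j) • x) l := by
    rw [map_smul, Pi.smul_apply, smul_eq_mul]
  have h1 : algebraMap R K (∏ j, a j) * algebraMap R K (ι' x l) =
      ∑ j, algebraMap R K (ι x j * ∏ i ∈ Finset.univ.erase j, a i) *
        algebraMap R K (ι' (m j) l) := by
    rw [← map_mul, h0, hx, map_sum, Finset.sum_apply, map_sum]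
    simp only [map_smul, Pi.smul_apply, smul_eq_mul, map_mul]
  rw [h1]
  simp only [Matrix.vecMul, dotProduct, Matrix.of_apply, Finset.mul_sum]
  refine Finset.sum_congr rfl fun j _ => ?_
  rw [map_mul, ← hAj j]
  ring

/-- **Minors change by a constant.** If `ι : M →ₗ[R] (Fin r → R)` is injective with torsion
cokernel and `ι' : M →ₗ[R] (Fin r → R)` is any linear map, then there is ONE `c ∈ K` with
`det (algebraMap R K (ι' (g i) j))ᵢⱼ = c * det (algebraMap R K (ι (g i) j))ᵢⱼ` for every
`g : Fin r → M`. -/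
theorem minorEmbedding_exists_det_eq_mul_det (R K : Type) [CommRing R] [Field K] [Algebra R K]
    (hRK : Function.Injective (algebraMap R K)) (M : Type) [AddCommGroup M] [Module R M]
    (r : ℕ) (ι ι' : M →ₗ[R] (Fin r → R)) (hι : Function.Injective ι)
    (htor : ∀ z : Fin r → R, ∃ a : R, a ≠ 0 ∧ a • z ∈ LinearMap.range ι) :
    ∃ c : K, ∀ g : Fin r → M,
      Matrix.det (Matrix.of fun i j => algebraMap R K (ι' (g i) j)) =
        c * Matrix.det (Matrix.of fun i j => algebraMap R K (ι (g i) j)) := by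
  obtain ⟨Q, hQ⟩ := minorEmbedding_exists_matrix_vecMul_eq R K hRK M r r ι ι' hι htor
  refine ⟨Q.det, fun g => ?_⟩
  have h : (Matrix.of fun i j => algebraMap R K (ι' (g i) j)) =
      (Matrix.of fun i j => algebraMap R K (ι (g i) j)) * Q := by
    ext i j
    have := congrFun (hQ (g i)) j
    simpa [Matrix.mul_apply, Matrix.vecMul, dotProduct] using this
  rw [h, Matrix.det_mul, mul_comm]

/-- **A non-vanishing minor.** If `ι : M →ₗ[R] (Fin r → R)` has torsion cokernel, then some
maximal minor of `ι` (computed in a field `K` into which `R` embeds) is non-zero: on elements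
`m j` with `ι (m j) = a j • Pi.single j 1`, `a j ≠ 0`, the minor is `∏ algebraMap R K (a j)`. -/
theorem minorEmbedding_exists_det_ne_zero (R K : Type) [CommRing R] [Field K] [Algebra R K]
    (hRK : Function.Injective (algebraMap R K)) (M : Type) [AddCommGroup M] [Module R M]
    (r : ℕ) (ι : M →ₗ[R] (Fin r → R))
    (htor : ∀ z : Fin r → R, ∃ a : R, a ≠ 0 ∧ a • z ∈ LinearMap.range ι) :
    ∃ g : Fin r → M, Matrix.det (Matrix.of fun i j => algebraMap R K (ι (g i) j)) ≠ 0 := by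
  classical
  choose a ha hm using fun j : Fin r => htor (Pi.single j 1)
  choose m hm using fun j => LinearMap.mem_range.1 (hm j)
  refine ⟨m, ?_⟩
  have h : (Matrix.of fun i j => algebraMap R K (ι (m i) j)) =
      Matrix.diagonal fun i => algebraMap R K (a i) := by
    ext i j
    by_cases hij : i = j
    · subst hij
      simp [hm]
    · simp [hm, hij, Ne.symm hij]
  rw [h, Matrix.det_diagonal]
  exact Finset.prod_ne_zero_iff.2 fun i _ => (map_ne_zero_iff _ hRK).2 (ha i)

/-- **STUB `stub_minor_embedding_indep`.** Two embeddings `ι, ι'` of a module `M` into `R^r`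
with torsion cokernels differ, over a field `K` into which `R` embeds, by an invertible matrix,
so their maximal minors on every `r`-tuple of elements of `M` differ by ONE non-zero constant
`c ∈ K`. [folklore] -/
theorem stub_minor_embedding_indep : ∀ (R K : Type) [CommRing R] [Field K] [Algebra R K],
    Function.Injective (algebraMap R K) →
    ∀ (M : Type) [AddCommGroup M] [Module R M] (r : ℕ) (ι ι' : M →ₗ[R] (Fin r → R)),
      Function.Injective ι → Function.Injective ι' →
      (∀ z : Fin r → R, ∃ a : R, a ≠ 0 ∧ a • z ∈ LinearMap.range ι) →
      (∀ z : Fin r → R, ∃ a : R, a ≠ 0 ∧ a • z ∈ LinearMap.range ι') →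
      ∃ c : K, c ≠ 0 ∧ ∀ g : Fin r → M,
        Matrix.det (Matrix.of fun i j => algebraMap R K (ι' (g i) j)) =
          c * Matrix.det (Matrix.of fun i j => algebraMap R K (ι (g i) j)) := by
  intro R K _ _ _ hRK M _ _ r ι ι' hι hι' htor htor'
  obtain ⟨c, hc⟩ := minorEmbedding_exists_det_eq_mul_det R K hRK M r ι ι' hι htor
  obtain ⟨c', hc'⟩ := minorEmbedding_exists_det_eq_mul_det R K hRK M r ι' ι hι' htor'
  obtain ⟨g₀, hg₀⟩ := minorEmbedding_exists_det_ne_zero R K hRK M r ι htor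
  refine ⟨c, ?_, hc⟩
  rintro rfl
  apply hg₀
  rw [hc' g₀, hc g₀, zero_mul, mul_zero]

end Summit.ResolutionOfSingularities.ResolutionOfSingularities.Theorems.SyzygyFlattening

end
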